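import Mathlib.RingTheory.RegularLocalRing.Defs
import Mathlib.RingTheory.Localization.AtPrime.Basic
import Mathlib.RingTheory.Ideal.Quotient.Operations
import Literature.AlgebraicGeometry.Tropical.InitialIdeal
import HarnessLib

/-!
# Schön ideals: all initial degenerations regular (Tevelev 2007, in the Gröbner form)

Definition item `defn-IsSchonIdeal` (topic `Literature/AlgebraicGeometry/Tropical`), requested by route
`ResolutionOfSingularities/TropicalLinks`.

## The printed notion (Tevelev 2007 = arXiv:math/0412329, p. 1, read)

"Let `X` be a connected closed subvariety of an algebraic torus `T` over an algebraically closed field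
`k`. … Consider the multiplication map `Ψ : T × X̄ → ℙ`, `(t, x) ↦ tx`. **Definition 1.1.** We call `X̄` a
tropical compactification if `Ψ` is faithfully flat and `X̄` is proper. … **Definition 1.3.** A subvariety
`X` of a torus `T` is called schön if it has a tropical compactification with a smooth multiplication
map. **Theorem 1.4.** If `X` is schön then any of its tropical compactifications `X̄ ⊂ ℙ` has a smooth
multiplication map, is regularly embedded, normal, has toroidal singularities, …"

## What is defined here: the GRÖBNER FORM used by the route

`IsSchonIdeal I`, for an ideal `I` of the Laurent polynomial ring
`k[x₁^±, …, x_N^±] = AddMonoidAlgebra k (Fin N → ℤ)`: for EVERY integer weight `w ∈ ℤ^N` the initial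
degeneration `k[x^±]/in_w(I)` (`weightInitialIdeal w I`, file `Tropical/InitialIdeal`) is a regular
ring — all its localizations at prime ideals are regular local rings (Mathlib `IsRegularLocalRing`);
when `in_w(I) = ⊤` (i.e. `w ∉ Trop V(I)`) the quotient is the zero ring, has no primes, and the
condition holds vacuously. Over an algebraically closed field "regular" is "smooth", and the fibres of
the flat multiplication map of a tropical compactification over the torus orbit of a cone `σ` are the
initial degenerations `in_w(X)`, `w ∈ relint σ` (Luxton–Qu 2011, §2; Helm–Katz 2012, Prop. 3.9), so
that this is Tevelev's schön-ness for `X = V(I)`; that identification is a FACT about toric geometry,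
not part of this definition (see below). This is the shape in which the route's items (SchonPlus,
SchonResolves, SchonLowDim) inline the condition.

## Proved API

`isSchonIdeal_iff` (unfolding); `isSchonIdeal_top` (the empty subscheme is schön); from schön-ness at
the weight `w = 0`, `in_0(I) = I`: the quotient `k[x^±]/I` itself is regular
(`IsSchonIdeal.isRegularLocalRing_localization_quotient`).

## What is NOT here — and why no named fact is vendored with this definition

The requested facts — (F1) Tevelev 2007, Thm. 1.4 and Thm. 1.2 (schön ⇒ every tropical
compactification has smooth structure map; in a smooth toric variety `X(Σ)` with `|Σ| ⊇ Trop U` the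
closure is smooth with combinatorial normal crossings boundary); (F2) Luxton–Qu 2011
(arXiv:0902.2009), Thm. 1.5 (schön ⇒ every fan supported on `Trop U` is tropical); (F3) loc. cit.
Lemma 2.13 (schön in some torus ⇒ schön in the intrinsic torus); (F4) Helm–Katz 2012, Prop. 3.9 /
Luxton–Qu §2 (`U` schön ⇔ `in_w(U)` smooth for all `w ∈ Trop U`, identifying `IsSchonIdeal` with
Tevelev-schön over `k = k̄`); (F5) Luxton–Qu Prop. 3.1 (snc pair ⇒ schön embedding) — are all
statements about TORIC VARIETIES OF FANS `X(Σ)`, closures of `U` in them, properness and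
(faithful) flatness / smoothness of the multiplication map `T × Ū → X(Σ)`. The tree has no toric
variety of a fan, no tropical compactification and no tropical variety `Trop U` as a polyhedral
object (`lean search`: no `ToricVariety` / `PolyhedralFan` / `TropicalCompactification` declarations),
so none of (F1)–(F5) can be STATED faithfully yet; they need definition items (toric variety of a
rational fan, tropical compactification) first, and are deliberately not approximated here.

## References

* J. Tevelev, *Compactifications of subvarieties of tori*, Amer. J. Math. 129 (2007) 1087–1104
  (arXiv:math/0412329), Def. 1.1, Def. 1.3, Thm. 1.2, Thm. 1.4 (read). [Tevelev2007]
* M. Luxton, Z. Qu, *Some results on tropical compactifications*, Trans. AMS 363 (2011) 4853–4876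
  (arXiv:0902.2009, *On tropical compactifications*), §2, Thm. 1.5, Lemma 2.13, Prop. 3.1.
  [LuxtonQu2009]
* D. Helm, E. Katz, *Monodromy filtrations and the topology of tropical varieties*, Canad. J. Math. 64
  (2012), Prop. 3.9. [HelmKatz2012]
* D. Maclagan, B. Sturmfels, *Introduction to Tropical Geometry* (2015), §2.4, §6.4.
  [MaclaganSturmfels2015]
-/

noncomputable section

open AddMonoidAlgebra

namespace Literature.AlgebraicGeometry.Tropical

universe u

variable {k : Type u} [Field k] {N : ℕ}

/-- **Schön ideal (Gröbner form of Tevelev's schön subvarieties of tori)**: the ideal `I` of the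
Laurent polynomial ring `k[x₁^±, …, x_N^±]` is schön if for EVERY weight `w ∈ ℤ^N` the initial
degeneration `k[x^±] ⧸ in_w(I)` is a regular ring: every localization at a prime ideal is a regular
local ring (vacuous when `in_w(I) = ⊤`, the zero ring having no primes). For `k` algebraically closed
and `X = V(I) ⊆ 𝔾_m^N` this is "`X` is schön" (Tevelev, Def. 1.3: some — equivalently, Thm. 1.4, every
— tropical compactification has SMOOTH multiplication map `T × X̄ → ℙ`), the fibres of the
multiplication map being the initial degenerations (module docstring).
[cite: Tevelev2007, Def. 1.3 and Thm. 1.4] -/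
def IsSchonIdeal (I : Ideal (AddMonoidAlgebra k (Fin N → ℤ))) : Prop :=
  ∀ (w : Fin N → ℤ) (P : Ideal (AddMonoidAlgebra k (Fin N → ℤ) ⧸ weightInitialIdeal w I)) [P.IsPrime],
    IsRegularLocalRing (Localization.AtPrime P)

/-- Unfolding of `IsSchonIdeal`. [folklore] -/
theorem isSchonIdeal_iff (I : Ideal (AddMonoidAlgebra k (Fin N → ℤ))) :
    IsSchonIdeal I ↔
      ∀ (w : Fin N → ℤ) (P : Ideal (AddMonoidAlgebra k (Fin N → ℤ) ⧸ weightInitialIdeal w I))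
        [P.IsPrime], IsRegularLocalRing (Localization.AtPrime P) :=
  Iff.rfl

/-- The unit ideal (the empty subscheme of the torus) is schön: every initial ideal is `⊤`, the
degenerations are the zero ring, which has no prime ideals. [folklore] -/
theorem isSchonIdeal_top : IsSchonIdeal (⊤ : Ideal (AddMonoidAlgebra k (Fin N → ℤ))) := by
  intro w P hP
  exfalso
  have htop : weightInitialIdeal w (⊤ : Ideal (AddMonoidAlgebra k (Fin N → ℤ))) = ⊤ := initialIdeal_top _
  haveI : Subsingleton (AddMonoidAlgebra k (Fin N → ℤ) ⧸
      weightInitialIdeal w (⊤ : Ideal (AddMonoidAlgebra k (Fin N → ℤ)))) :=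
    Ideal.Quotient.subsingleton_iff.2 htop
  exact hP.ne_top (Subsingleton.elim _ _)

/-- **A schön ideal defines a regular very affine scheme**: at the weight `w = 0` one has `in_0(I) = I`
(`weightInitialIdeal_zero`), so all localizations of `k[x^±] ⧸ I` at primes are regular local rings.
[cite: Tevelev2007, Thm. 1.4] -/
theorem IsSchonIdeal.isRegularLocalRing_localization_quotient {I : Ideal (AddMonoidAlgebra k (Fin N → ℤ))}
    (h : IsSchonIdeal I) (P : Ideal (AddMonoidAlgebra k (Fin N → ℤ) ⧸ I)) [P.IsPrime] :
    IsRegularLocalRing (Localization.AtPrime P) := by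
  have h0 := h 0
  rw [weightInitialIdeal_zero] at h0
  exact h0 P

end Literature.AlgebraicGeometry.Tropical

end
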